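import Mathlib
import Summits.ValiantsHypothesis.ValiantsHypothesis.Theorems.NewtonUnitEquationsDissociatedUniformTotalsLawHexagon
import HarnessLib

/-!
# Crux `NewtonUnitEquations.DissociatedUniform` (stmt-ValiantsHypothesis-5905): the dominant-third-curve regime POINTWISE —
# for `λ ≥ λ₀` every hull vertex of a class of `(a, b, λ•c)` is a pair (blob, fibre point) with a COMMON weak-top direction

Memo `Cruxes/DissociatedUniform/NOTES-d1g3.md` §2 L5 / NOTES-t1g8 §2 (regime formula).  `…TotalsLawLargeThird` proved the TOTALS in the
regime `c ↦ μ c`, `μ → ∞` (`T ≤ V_P + 2|G| + 14|G|²`).  The pointwise census of NOTES-t1g8 (one class with `≈ q²/2` vertices on the smooth stratum;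
co-oriented `≤ 3q`) lives in this regime and is governed by the formula `V_s = q + Σ_z #(edge normals of P_{s−z} inside the cone K_z of c z)`.
This file proves the UPPER half of that formula for ARBITRARY curves and every class, in the clean form

* `CommonDir a b c s z x` — the letter `c z` of the third curve and the fibre point `a x + b (s − z − x)` of `P_{s−z}` are weak tops of
  `C`, resp. `P_{s−z}`, for one and the same non-zero weight (for polygons in general position: the normal cone of the fibre vertex
  meets the normal cone `K_z`);
* **`classVert_smul_le_card_commonDir`**: there is `λ₀` such that for all `λ ≥ λ₀`,
  `V_s(a, b, λ•c) ≤ #{(z, x) : CommonDir z x}`.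
Proof: a hull vertex `λ c z + v` is a strict top for some weight `θ` (`KPTT.exists_isStrictTop_of_mem_extremePoints`), normalised to
`‖θ‖ = 1`; comparing inside the blob `z` makes `v` the top of its fibre at `θ`, comparing across blobs makes `c z` a `4M/λ`-approximate
top of `C` at `θ` (`defect_le_of_isStrictTop`, `M` = a bound on the fibre points); but for a pair WITHOUT a common direction the
"defect" `(max_{z'} θ·c z' − θ·c z) + (max_{x'} θ·v_{x'} − θ·v)` is a continuous positive function on the (compact) unit sphere, hence
`≥ δ > 0` (`exists_pos_le_defect`), which is absurd once `λ > 4M/δ`.  Finitely many pairs give `λ₀`.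
So in the regime the pointwise question "is `V_s = O(q)`?" is EXACTLY the combinatorial question "how many fibre vertices of `P_{s−z}` are
exposed inside the cone of `c z`, summed over `z`" — `≤ 3q` for co-oriented smooth triples and `≈ q²/2` for a contra-oriented fan in the
census (`exp/cones_dp.py`), cf. `…TotalsLawClassBounds`.
Honest label: a regime theorem (third curve dominant); `CoOrientedClassBound`, `SmoothSharpTotalsLaw`, `TotalsLawThree` OPEN; nothing here
bears on VP ≠ VNP.
[folklore: a continuous positive function on a compact set is bounded below by a positive constant]
-/

set_option linter.dupNamespace false -- `ValiantsHypothesis.ValiantsHypothesis` (summit = problem) in every name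

open scoped BigOperators

namespace Summit.ValiantsHypothesis.ValiantsHypothesis.Theorems.NewtonUnitEquationsDissociatedUniform

namespace TotalsLaw

open Literature.Computability.AlgebraicComplexity.KPTT.PlanarMinkowski

section LargeThirdPointwise

variable {q : ℕ} [NeZero q] (a b c : ZMod q → (Fin 2 → ℝ)) (s : ZMod q)

/-- The fibre point of `P_{s−z}` with first letter `x`: `a x + b (s − z − x)`. -/
def bpt (z x : ZMod q) : Fin 2 → ℝ := a x + b (s - z - x)

/-- **Common weak-top direction** of the letter `c z` (in `C`) and the fibre point `bpt z x` (in `P_{s−z}`). -/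
def CommonDir (z x : ZMod q) : Prop :=
  ∃ θ : Fin 2 → ℝ, θ ≠ 0 ∧ (∀ z', θ ⬝ᵥ c z' ≤ θ ⬝ᵥ c z) ∧ (∀ x', θ ⬝ᵥ bpt a b s z x' ≤ θ ⬝ᵥ bpt a b s z x)

/-- The DEFECT of the pair `(z, x)` at the weight `θ`: how far `c z` and `bpt z x` are from being the tops of `C`, `P_{s−z}` at `θ`
(a sum of two non-negative terms). -/
noncomputable def defect (z x : ZMod q) (θ : Fin 2 → ℝ) : ℝ :=
  (Finset.univ.sup' Finset.univ_nonempty fun z' => θ ⬝ᵥ c z') - θ ⬝ᵥ c z +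
    ((Finset.univ.sup' Finset.univ_nonempty fun x' => θ ⬝ᵥ bpt a b s z x') - θ ⬝ᵥ bpt a b s z x)

/-- The `C`-part of the defect is non-negative. [folklore] -/
theorem le_sup_c (z : ZMod q) (θ : Fin 2 → ℝ) :
    θ ⬝ᵥ c z ≤ Finset.univ.sup' Finset.univ_nonempty fun z' => θ ⬝ᵥ c z' :=
  Finset.le_sup' (fun z' => θ ⬝ᵥ c z') (Finset.mem_univ z)

/-- The fibre part of the defect is non-negative. [folklore] -/
theorem le_sup_bpt (z x : ZMod q) (θ : Fin 2 → ℝ) :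
    θ ⬝ᵥ bpt a b s z x ≤ Finset.univ.sup' Finset.univ_nonempty fun x' => θ ⬝ᵥ bpt a b s z x' :=
  Finset.le_sup' (fun x' => θ ⬝ᵥ bpt a b s z x') (Finset.mem_univ x)

/-- Zero defect at a non-zero weight means a common direction. [folklore] -/
theorem commonDir_of_defect_eq_zero {z x : ZMod q} {θ : Fin 2 → ℝ} (hθ : θ ≠ 0) (h : defect a b c s z x θ ≤ 0) :
    CommonDir a b c s z x := by
  have h1 := le_sup_c c z θ
  have h2 := le_sup_bpt a b s z x θ
  unfold defect at h
  refine ⟨θ, hθ, fun z' => ?_, fun x' => ?_⟩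
  · have := Finset.le_sup' (fun z' => θ ⬝ᵥ c z') (Finset.mem_univ z')
    linarith
  · have := Finset.le_sup' (fun x' => θ ⬝ᵥ bpt a b s z x') (Finset.mem_univ x')
    linarith

/-- The defect is continuous in the weight. [folklore] -/
theorem continuous_defect (z x : ZMod q) : Continuous (defect a b c s z x) := by
  unfold defect
  fun_prop

/-- **No common direction ⇒ the defect is bounded below by a positive constant on the unit sphere** (extreme value theorem on the
compact sphere of `ℝ²`). [folklore] -/
theorem exists_pos_le_defect {z x : ZMod q} (h : ¬ CommonDir a b c s z x) :
    ∃ δ : ℝ, 0 < δ ∧ ∀ θ : Fin 2 → ℝ, ‖θ‖ = 1 → δ ≤ defect a b c s z x θ := by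
  have hK : IsCompact (Metric.sphere (0 : Fin 2 → ℝ) 1) := isCompact_sphere _ _
  have hne : (Metric.sphere (0 : Fin 2 → ℝ) 1).Nonempty := by
    refine ⟨fun _ => 1, ?_⟩
    rw [mem_sphere_zero_iff_norm, pi_norm_const, norm_one]
  obtain ⟨θ₀, hθ₀, hmin⟩ := hK.exists_isMinOn hne (continuous_defect a b c s z x).continuousOn
  have hθ₀' : ‖θ₀‖ = 1 := by simpa using hθ₀
  have hθ₀ne : θ₀ ≠ 0 := by
    intro h0; rw [h0, norm_zero] at hθ₀'; exact zero_ne_one hθ₀'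
  refine ⟨defect a b c s z x θ₀, ?_, fun θ hθ => hmin (by simpa using hθ)⟩
  by_contra hle
  rw [not_lt] at hle
  exact h (commonDir_of_defect_eq_zero a b c s hθ₀ne hle)

/-- A uniform bound for pairings with unit weights: `|θ·u| ≤ 2‖u‖` when `‖θ‖ = 1` (sup norms on `ℝ²`). [folklore] -/
theorem abs_dotProduct_le_two_mul_norm {θ : Fin 2 → ℝ} (hθ : ‖θ‖ = 1) (u : Fin 2 → ℝ) : |θ ⬝ᵥ u| ≤ 2 * ‖u‖ := by
  have h0 : |θ 0| ≤ 1 := by have := norm_le_pi_norm θ 0; rw [Real.norm_eq_abs] at this; linarith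
  have h1 : |θ 1| ≤ 1 := by have := norm_le_pi_norm θ 1; rw [Real.norm_eq_abs] at this; linarith
  have hu0 : |u 0| ≤ ‖u‖ := by have := norm_le_pi_norm u 0; rwa [Real.norm_eq_abs] at this
  have hu1 : |u 1| ≤ ‖u‖ := by have := norm_le_pi_norm u 1; rwa [Real.norm_eq_abs] at this
  have e : θ ⬝ᵥ u = θ 0 * u 0 + θ 1 * u 1 := by simp [dotProduct, Fin.sum_univ_two]
  rw [e]
  have := abs_add_le (θ 0 * u 0) (θ 1 * u 1)
  rw [abs_mul, abs_mul] at this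
  nlinarith [abs_nonneg (θ 0), abs_nonneg (u 0), abs_nonneg (θ 1), abs_nonneg (u 1)]

/-- A bound on all fibre points: `M = max_{z,x} ‖bpt z x‖`. -/
noncomputable def bigM : ℝ :=
  Finset.univ.sup' Finset.univ_nonempty fun zx : ZMod q × ZMod q => ‖bpt a b s zx.1 zx.2‖

/-- Every fibre point has norm at most `M`. [folklore] -/
theorem norm_bpt_le (z x : ZMod q) : ‖bpt a b s z x‖ ≤ bigM a b s :=
  Finset.le_sup' (fun zx : ZMod q × ZMod q => ‖bpt a b s zx.1 zx.2‖) (Finset.mem_univ (z, x))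

/-- `M ≥ 0`. [folklore] -/
theorem bigM_nonneg : 0 ≤ bigM a b s := (norm_nonneg _).trans (norm_bpt_le a b s 0 0)

/-- The class point of the pair `(z, x)` for the scaled third curve. [folklore] -/
theorem smul_add_bpt_mem (μ : ℝ) (z x : ZMod q) :
    μ • c z + bpt a b s z x ∈ classFin a b (μ • c) s := by
  have : μ • c z + bpt a b s z x = a x + b (s - z - x) + (μ • c) z := by
    rw [bpt, Pi.smul_apply]; abel
  rw [this]
  exact mem_classFin_of_sum_eq (by ring)

/-- **A strict top has small defect.**  If `λ c z + bpt z x` is the strict top of the class of `(a, b, λ•c)` at a unit weight `θ`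
(`λ > 0`), then `bpt z x` is the top of its fibre at `θ` and `c z` is within `4M/λ` of the top of `C`:
`defect z x θ ≤ 4M/λ`. [folklore] -/
theorem defect_le_of_isStrictTop {μ : ℝ} (hμ : 0 < μ) {z x : ZMod q} {θ : Fin 2 → ℝ} (hθ : ‖θ‖ = 1)
    (htop : IsStrictTop θ (classFin a b (μ • c) s) (μ • c z + bpt a b s z x)) :
    defect a b c s z x θ ≤ 4 * bigM a b s / μ := by
  -- comparison with every class point `μ c z' + bpt z' x'`
  have hcmp : ∀ z' x', μ * (θ ⬝ᵥ c z') + θ ⬝ᵥ bpt a b s z' x' ≤ μ * (θ ⬝ᵥ c z) + θ ⬝ᵥ bpt a b s z x := by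
    intro z' x'
    have h := htop.le (smul_add_bpt_mem a b c s μ z' x')
    rwa [dotProduct_add, dotProduct_add, dotProduct_smul, dotProduct_smul, smul_eq_mul, smul_eq_mul] at h
  -- fibre part: zero defect
  obtain ⟨x₁, -, hx₁⟩ := Finset.exists_mem_eq_sup' (Finset.univ_nonempty (α := ZMod q)) fun x' => θ ⬝ᵥ bpt a b s z x'
  have hP : (Finset.univ.sup' Finset.univ_nonempty fun x' => θ ⬝ᵥ bpt a b s z x') ≤ θ ⬝ᵥ bpt a b s z x := by
    rw [hx₁]
    have := hcmp z x₁
    nlinarith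
  -- `C` part: `μ (θ·c z' − θ·c z) ≤ θ·(bpt z x − bpt z' x') ≤ 4M`
  obtain ⟨z₁, -, hz₁⟩ := Finset.exists_mem_eq_sup' (Finset.univ_nonempty (α := ZMod q)) fun z' => θ ⬝ᵥ c z'
  have hC : μ * ((Finset.univ.sup' Finset.univ_nonempty fun z' => θ ⬝ᵥ c z') - θ ⬝ᵥ c z) ≤ 4 * bigM a b s := by
    rw [hz₁]
    have h := hcmp z₁ x
    have b1 := abs_dotProduct_le_two_mul_norm hθ (bpt a b s z x)
    have b2 := abs_dotProduct_le_two_mul_norm hθ (bpt a b s z₁ x)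
    have m1 := norm_bpt_le a b s z x
    have m2 := norm_bpt_le a b s z₁ x
    have := abs_le.1 b1
    have := abs_le.1 b2
    nlinarith
  unfold defect
  rw [le_div_iff₀ hμ]
  have hP' := le_sup_bpt a b s z x θ
  nlinarith [le_sup_c c z θ]

/-- **Per pair**: without a common direction, for `λ` large the class point of `(z, x)` is never a strict top at a unit weight.
[folklore] -/
theorem exists_lambda_not_isStrictTop {z x : ZMod q} (h : ¬ CommonDir a b c s z x) :
    ∃ μ₀ : ℝ, ∀ μ : ℝ, μ₀ ≤ μ → ∀ θ : Fin 2 → ℝ, ‖θ‖ = 1 →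
      ¬ IsStrictTop θ (classFin a b (μ • c) s) (μ • c z + bpt a b s z x) := by
  obtain ⟨δ, hδ, hδle⟩ := exists_pos_le_defect a b c s h
  refine ⟨4 * bigM a b s / δ + 1, fun μ hμ θ hθ htop => ?_⟩
  have hM := bigM_nonneg a b s
  have hμpos : 0 < μ := by
    have : 0 ≤ 4 * bigM a b s / δ := by positivity
    linarith
  have h1 := hδle θ hθ
  have h2 := defect_le_of_isStrictTop a b c s hμpos hθ htop
  -- δ ≤ 4M/μ with μ > 4M/δ
  have h3 : δ * μ ≤ 4 * bigM a b s := by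
    have := (le_div_iff₀ hμpos).1 (h1.trans h2)
    linarith
  have h4 : 4 * bigM a b s < δ * μ := by
    have h5 : 4 * bigM a b s / δ < μ := by linarith
    have h6 := (div_lt_iff₀ hδ).1 h5
    linarith [mul_comm μ δ]
  linarith

/-- There is always at least one pair with a common direction (take any non-zero weight and the two maximisers). [folklore] -/
theorem exists_commonDir : ∃ z x, CommonDir a b c s z x := by
  classical
  set θ : Fin 2 → ℝ := fun _ => 1 with hθ
  have hθne : θ ≠ 0 := by
    intro h; have := congrFun h 0; simp [hθ] at this
  obtain ⟨z, -, hz⟩ := Finset.exists_max_image Finset.univ (fun z' => θ ⬝ᵥ c z') Finset.univ_nonempty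
  obtain ⟨x, -, hx⟩ := Finset.exists_max_image Finset.univ (fun x' => θ ⬝ᵥ bpt a b s z x') Finset.univ_nonempty
  exact ⟨z, x, θ, hθne, fun z' => hz z' (Finset.mem_univ _), fun x' => hx x' (Finset.mem_univ _)⟩

/-- **THE REGIME THEOREM (pointwise, third curve dominant).**  For every class `s` there is `λ₀` such that for all `λ ≥ λ₀` the
class `s` of `(a, b, λ • c)` has at most as many hull vertices as there are pairs `(z, x)` (blob, fibre letter) with a COMMON weak-top
direction of `c z` in `C` and of `a x + b(s − z − x)` in `P_{s−z}`. [folklore] -/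
theorem classVert_smul_le_card_commonDir [DecidablePred fun zx : ZMod q × ZMod q => CommonDir a b c s zx.1 zx.2] :
    ∃ μ₀ : ℝ, ∀ μ : ℝ, μ₀ ≤ μ →
      classVert a b (μ • c) s ≤ (Finset.univ.filter fun zx : ZMod q × ZMod q => CommonDir a b c s zx.1 zx.2).card := by
  classical
  -- a threshold for every pair (0 for pairs with a common direction)
  have hpair : ∀ zx : ZMod q × ZMod q, ∃ μ₀ : ℝ, ¬ CommonDir a b c s zx.1 zx.2 → ∀ μ : ℝ, μ₀ ≤ μ →
      ∀ θ : Fin 2 → ℝ, ‖θ‖ = 1 → ¬ IsStrictTop θ (classFin a b (μ • c) s) (μ • c zx.1 + bpt a b s zx.1 zx.2) := by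
    intro zx
    by_cases h : CommonDir a b c s zx.1 zx.2
    · exact ⟨0, fun h' => absurd h h'⟩
    · obtain ⟨μ₀, hμ₀⟩ := exists_lambda_not_isStrictTop a b c s h
      exact ⟨μ₀, fun _ => hμ₀⟩
  choose lam hlam using hpair
  refine ⟨Finset.univ.sup' Finset.univ_nonempty lam, fun μ hμ => ?_⟩
  set S := Finset.univ.filter fun zx : ZMod q × ZMod q => CommonDir a b c s zx.1 zx.2 with hS
  -- every hull vertex is the class point of a pair with a common direction
  have hcover : (convexHull ℝ (classPts a b (μ • c) s)).extremePoints ℝ ⊆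
      ((S.image fun zx => μ • c zx.1 + bpt a b s zx.1 zx.2 : Finset (Fin 2 → ℝ)) : Set (Fin 2 → ℝ)) := by
    intro p hp
    rw [← coe_classFin] at hp
    obtain ⟨w, hw⟩ := exists_isStrictTop_of_mem_extremePoints hp
    obtain ⟨⟨x, y⟩, -, hpxy⟩ := Finset.mem_image.1 hw.mem
    set z : ZMod q := s - x - y with hz
    have hp_eq : p = μ • c z + bpt a b s z x := by
      rw [← hpxy, bpt, hz, Pi.smul_apply]
      have : s - (s - x - y) - x = y := by ring
      rw [this]; abel
    rw [Finset.coe_image, Set.mem_image]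
    refine ⟨(z, x), ?_, hp_eq.symm⟩
    rw [Finset.mem_coe, hS, Finset.mem_filter]
    refine ⟨Finset.mem_univ _, ?_⟩
    by_contra hno
    by_cases hw0 : w = 0
    · -- zero weight: strictness forces the class to be the single point `p`; then `p` is trivially a strict top at ANY unit
      -- weight, which the per-pair threshold forbids for a pair without a common direction
      exfalso
      have hall : ∀ y' ∈ classFin a b (μ • c) s, y' = p := by
        intro y' hy'
        by_contra hne
        have := hw.lt hy' hne
        rw [hw0, zero_dotProduct, zero_dotProduct] at this
        exact lt_irrefl _ this
      obtain ⟨θ₁, hθ₁⟩ : ∃ θ₁ : Fin 2 → ℝ, ‖θ₁‖ = 1 := ⟨fun _ => 1, by rw [pi_norm_const, norm_one]⟩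
      have htop₁ : IsStrictTop θ₁ (classFin a b (μ • c) s) (μ • c z + bpt a b s z x) := by
        refine ⟨smul_add_bpt_mem a b c s μ z x, fun y' hy' hne => ?_⟩
        exact absurd ((hall y' hy').trans hp_eq) hne
      have hμ' : lam (z, x) ≤ μ := (Finset.le_sup' lam (Finset.mem_univ (z, x))).trans hμ
      exact hlam (z, x) hno μ hμ' θ₁ hθ₁ htop₁
    · -- normalise the weight and apply the per-pair threshold
      have hnorm : 0 < ‖w‖ := norm_pos_iff.2 hw0
      set θ : Fin 2 → ℝ := (1 / ‖w‖) • w with hθ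
      have hθ1 : ‖θ‖ = 1 := by
        rw [hθ, norm_smul, norm_div, norm_one, Real.norm_eq_abs, abs_of_pos hnorm, one_div_mul_cancel hnorm.ne']
      have htopθ : IsStrictTop θ (classFin a b (μ • c) s) (μ • c z + bpt a b s z x) := by
        rw [← hp_eq]; exact hw.smul_pos (by positivity)
      have hμ' : lam (z, x) ≤ μ := (Finset.le_sup' lam (Finset.mem_univ (z, x))).trans hμ
      exact hlam (z, x) hno μ hμ' θ hθ1 htopθ
  unfold classVert
  calc ((convexHull ℝ (classPts a b (μ • c) s)).extremePoints ℝ).ncard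
      ≤ (((S.image fun zx => μ • c zx.1 + bpt a b s zx.1 zx.2 : Finset (Fin 2 → ℝ))) : Set (Fin 2 → ℝ)).ncard :=
        Set.ncard_le_ncard hcover (Finset.finite_toSet _)
    _ = (S.image fun zx => μ • c zx.1 + bpt a b s zx.1 zx.2).card := Set.ncard_coe_finset _
    _ ≤ S.card := Finset.card_image_le

end LargeThirdPointwise

end TotalsLaw

end Summit.ValiantsHypothesis.ValiantsHypothesis.Theorems.NewtonUnitEquationsDissociatedUniform
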